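import Summits.BirchSwinnertonDyer.BirchSwinnertonDyer.Theorems.KolyvaginRoadThreeSchneiderTamAtThreeHeightLogNumeratorDeepRefined
import Literature.NumberTheory.EllipticCurves.TateCurve.UniformizationAnnulus
import HarnessLib

/-!
# Crux `SchneiderTamAtThree` (item 19154) — THE HEIGHT IS THE LOGARITHM OF THE NUMERATOR, DEEP POINTS,
# part 7a: the Tate sigma product to FIRST order in `ch L − 1` and ALL orders in `q`
# (`Π = 1 − 4(ch L − 1)·s₁(q) + O(q²(ch L − 1)²)`, `s₁(q) = Σ_{n≥1} qⁿ/(1 − qⁿ)² = Σ σ₁(n)qⁿ`)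

HONEST FRAMING (cell `bsd-stepL`, seat `bsd-stepL-tam3-p2` g3, WIDTH-LEVER second lane «closed-form Schneider
local factor at 3 … finite case table proved once»; `--supports stmt-BirchSwinnertonDyer-19154 --as helper`):
THEOREMS ONLY, unconditional, route-independent (no Theses import); 0 definitions, 0 named facts, 0 sorry;
pure `ℚ₃`-analysis lemmas for the EXACT second-order law (part 7b); nothing here proves the crux
`SchneiderTamAtThree`, Schneider's conjecture or BSD.

* `tateS_one_eq_tsum_lambert`, `hasSum_lambert_one` — the Lambert form of `s₁(q) = Σ σ₁(n)qⁿ` in `ℚ₃`: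
  `s₁(q) = Σ_{n≥1} qⁿ/(1 − qⁿ)²` (the tree's `tsum_pnat_tateXTerm` at `v = 1`), so `E₂(q) = 1 − 24 s₁(q)`.
* `norm_prod_tateSigmaSq_factor_sub_lambert_le` / `norm_tprod_tateSigmaSq_factor_sub_lambert_le` — for
  `‖q‖₃ < 1`, `‖c‖₃ ≤ 1`: **`‖Π − (1 − 4(c − 1)·s₁(q))‖ ≤ ‖q‖²·‖c − 1‖²`**, `Π = ∏_{n≥1}(1 − 2qⁿc + q²ⁿ)²/(1 − qⁿ)⁴`
  (each factor is `(1 − 2(c−1)qⁿ/(1−qⁿ)²)²`; ultrametric bookkeeping of the cross terms). Lane A's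
  `KernelCert.norm_tprod_tateSigmaSq_factor_sub_linear_le` is the truncation `s₁ ≡ q (mod q²)` of this.
* `exact_logPr` — abstract bookkeeping: `‖log₃ Π + 2 s₁(q)·L‖ ≤ ‖L‖²` from the product estimate,
  `‖log(1+w) − w‖ ≤ ‖w‖²` and `‖2(ch L − 1) − L‖ ≤ 3‖L‖²`.
* `norm_lambertScale_eq_one`, `norm_lambertScale_sub_le`, `norm_lambertScale_sq_sub_sq_div_le` — the
  corrected scale `C' = C⁻²·E₂(q)` is a unit with `‖C' − b₂‖ ≤ 3⁻¹` and `‖(C'² − C⁻⁴)/1440‖ ≤ 1`.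

References: [SteinWuthrich2013] §4.2 (the sigma product); [SilvermanATAEC1994] V.1 Remark 1.2, V.3.1 (Lambert
series); tree: `TateCurve/UniformizationAnnulus` (`tsum_pnat_tateXTerm`), `…Rung62310y1HeightEvalSigma`
(`multipliable_tateSigmaSq_factor`), deep parts 5–6.
-/

noncomputable section

open scoped Classical Nat
open Filter Topology IsUltrametricDist PowerSeries
open WeierstrassCurve Literature.NumberTheory.EllipticCurves
open Literature.NumberTheory.EllipticCurves.SteinWuthrich2013
open Literature.NumberTheory.EllipticCurves.TateCurve
open Literature.NumberTheory.EllipticCurves.Rank1Residual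
open Summit.BirchSwinnertonDyer.Uniform.UI.O2
open Summit.BirchSwinnertonDyer.Rank1Residual.X11b.RegMult.Rung62310y1

namespace Summit.BirchSwinnertonDyer.Rank1Residual.X11b.RegMult.HeightLogNumerator

/-! ### §15 The Lambert series `s₁(q) = Σ qⁿ/(1 − qⁿ)²` in `ℚ₃` -/

section Lambert

/-- **Lambert form of `s₁`** in `ℚ₃`: for `‖q‖₃ < 1`, `s₁(q) = Σ_{n≥1} σ₁(n)qⁿ = Σ_{n≥1} qⁿ/(1 − qⁿ)²`
(the tree's rearrangement `tsum_pnat_tateXTerm` at `v = 1`, re-indexed over `ℕ`).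
[cite: SilvermanATAEC1994, Remark V.1.2 (PDF p. 386) and Thm. V.3.1 (c)] -/
theorem tateS_one_eq_tsum_lambert {q : ℚ_[3]} (hq : ‖q‖ < 1) :
    tateS 1 q = ∑' n : ℕ, q ^ (n + 1) / (1 - q ^ (n + 1)) ^ 2 := by
  have hq1 : ‖q * 1‖ < 1 := by rwa [mul_one]
  rw [tateS_one_eq_tsum_pnat, ← tsum_pnat_tateXTerm hq hq1,
    ← tsum_pnat_eq_tsum_succ (f := fun n : ℕ ↦ q ^ n / (1 - q ^ n) ^ 2)]
  refine tsum_congr fun n ↦ ?_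
  rw [tateXTerm, zpow_natCast, mul_one]

/-- Termwise bound `‖qⁿ⁺¹/(1 − qⁿ⁺¹)²‖ = ‖q‖ⁿ⁺¹ ≤ ‖q‖` for `‖q‖ < 1`. [folklore] -/
theorem norm_lambert_term_le {q : ℚ_[3]} (hq : ‖q‖ < 1) (n : ℕ) :
    ‖q ^ (n + 1) / (1 - q ^ (n + 1)) ^ 2‖ = ‖q‖ ^ (n + 1) ∧ ‖q ^ (n + 1) / (1 - q ^ (n + 1)) ^ 2‖ ≤ ‖q‖ := by
  have hqn : ‖q ^ (n + 1)‖ < 1 := by rw [norm_pow]; exact pow_lt_one₀ (norm_nonneg _) hq (by omega)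
  have h1 : ‖q ^ (n + 1) / (1 - q ^ (n + 1)) ^ 2‖ = ‖q‖ ^ (n + 1) := by
    rw [norm_div, norm_pow (1 - q ^ (n + 1)), norm_one_sub_eq_one hqn, one_pow, div_one, norm_pow]
  refine ⟨h1, ?_⟩
  rw [h1, pow_succ]
  exact mul_le_of_le_one_left (norm_nonneg _) (pow_le_one₀ (norm_nonneg _) hq.le)

/-- The Lambert series `Σ qⁿ⁺¹/(1 − qⁿ⁺¹)²` is summable in `ℚ₃` for `‖q‖₃ < 1` (geometric majorant). [folklore] -/
theorem summable_lambert_one {q : ℚ_[3]} (hq : ‖q‖ < 1) :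
    Summable fun n : ℕ ↦ q ^ (n + 1) / (1 - q ^ (n + 1)) ^ 2 := by
  refine Summable.of_norm_bounded ((summable_geometric_of_lt_one (norm_nonneg q) hq).mul_left ‖q‖) fun n ↦ ?_
  rw [(norm_lambert_term_le hq n).1, pow_succ, mul_comm]

/-- `HasSum (n ↦ qⁿ⁺¹/(1 − qⁿ⁺¹)²) (s₁(q))` in `ℚ₃` for `‖q‖₃ < 1`.
[cite: SilvermanATAEC1994, Remark V.1.2 (PDF p. 386)] -/
theorem hasSum_lambert_one {q : ℚ_[3]} (hq : ‖q‖ < 1) :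
    HasSum (fun n : ℕ ↦ q ^ (n + 1) / (1 - q ^ (n + 1)) ^ 2) (tateS 1 q) := by
  rw [tateS_one_eq_tsum_lambert hq]
  exact (summable_lambert_one hq).hasSum

/-- `‖s₁(q)‖₃ ≤ ‖q‖₃` for `‖q‖₃ < 1` (the tree's `norm_tateS_le`). [cite: SilvermanATAEC1994, Thm. V.3.1 (a)] -/
theorem norm_tateS_one_le {q : ℚ_[3]} (hq : ‖q‖ < 1) : ‖tateS 1 q‖ ≤ ‖q‖ :=
  norm_tateS_le hq.le

end Lambert

/-! ### §16 The sigma product to first order in `c − 1`, all orders in `q` -/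

section Product

/-- A sigma factor is a perfect square: `(1 − 2Qc + Q²)/(1 − Q)² = 1 − 2(c − 1)·Q/(1 − Q)²` (`‖Q‖ < 1`). [folklore] -/
theorem tateSigmaSq_factor_eq_sq {Q c : ℚ_[3]} (hQ : ‖Q‖ < 1) :
    (1 - 2 * Q * c + Q ^ 2) ^ 2 / (1 - Q) ^ 4 = (1 - 2 * (c - 1) * (Q / (1 - Q) ^ 2)) ^ 2 := by
  have hB : ‖1 - Q‖ = 1 := norm_one_sub_eq_one hQ
  have hB0 : (1 - Q) ≠ 0 := by intro h; rw [h, norm_zero] at hB; exact zero_ne_one hB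
  field_simp
  ring

/-- **Finite version.** For `‖q‖₃ < 1`, `‖c‖₃ ≤ 1` and every finite set `s` of indices:
`‖∏_{n∈s} f_n − (1 − 4(c − 1)·Σ_{n∈s} g_n)‖ ≤ ‖q‖²‖c − 1‖²`, `f_n = (1 − 2qⁿ⁺¹c + q^{2(n+1)})²/(1 − qⁿ⁺¹)⁴ =
(1 − 2(c−1)g_n)²`, `g_n = qⁿ⁺¹/(1 − qⁿ⁺¹)²` (induction on `s`; the new cross terms are
`4(c−1)²g_a(4G + g_a − 4(c−1)g_aG)` with `‖g_a‖, ‖G‖ ≤ ‖q‖`). [cite: SteinWuthrich2013, §4.2] -/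
theorem norm_prod_tateSigmaSq_factor_sub_lambert_le {q c : ℚ_[3]} (hq : ‖q‖ < 1) (hc : ‖c‖ ≤ 1)
    (s : Finset ℕ) :
    ‖∏ n ∈ s, (1 - 2 * q ^ (n + 1) * c + q ^ (2 * (n + 1))) ^ 2 / (1 - q ^ (n + 1)) ^ 4 -
        (1 - 4 * (c - 1) * ∑ n ∈ s, q ^ (n + 1) / (1 - q ^ (n + 1)) ^ 2)‖ ≤ ‖q‖ ^ 2 * ‖c - 1‖ ^ 2 := by
  classical
  set g : ℕ → ℚ_[3] := fun n ↦ q ^ (n + 1) / (1 - q ^ (n + 1)) ^ 2 with hg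
  set f : ℕ → ℚ_[3] := fun n ↦ (1 - 2 * q ^ (n + 1) * c + q ^ (2 * (n + 1))) ^ 2 / (1 - q ^ (n + 1)) ^ 4
    with hf
  have hfg : ∀ n, f n = (1 - 2 * (c - 1) * g n) ^ 2 := fun n ↦ by
    have hqn : ‖q ^ (n + 1)‖ < 1 := by rw [norm_pow]; exact pow_lt_one₀ (norm_nonneg _) hq (by omega)
    simp only [hf, hg]
    rw [show q ^ (2 * (n + 1)) = (q ^ (n + 1)) ^ 2 by rw [← pow_mul, mul_comm]]
    exact tateSigmaSq_factor_eq_sq hqn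
  have hgn : ∀ n, ‖g n‖ ≤ ‖q‖ := fun n ↦ (norm_lambert_term_le hq n).2
  have h4 : ‖(4 : ℚ_[3])‖ ≤ 1 := by
    rw [show (4 : ℚ_[3]) = ((4 : ℤ) : ℚ_[3]) by norm_cast]; exact Padic.norm_int_le_one _
  have h2 : ‖(2 : ℚ_[3])‖ ≤ 1 := by
    rw [show (2 : ℚ_[3]) = ((2 : ℤ) : ℚ_[3]) by norm_cast]; exact Padic.norm_int_le_one _
  have hc1 : ‖c - 1‖ ≤ 1 := (norm_sub_le_max₃ c 1).trans (max_le hc (by rw [norm_one]))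
  have hB0 : 0 ≤ ‖q‖ ^ 2 * ‖c - 1‖ ^ 2 := by positivity
  show ‖∏ n ∈ s, f n - (1 - 4 * (c - 1) * ∑ n ∈ s, g n)‖ ≤ ‖q‖ ^ 2 * ‖c - 1‖ ^ 2
  induction s using Finset.induction_on with
  | empty => simpa using hB0
  | insert a s ha ih =>
    rw [Finset.prod_insert ha, Finset.sum_insert ha]
    set P := ∏ n ∈ s, f n with hP
    set G := ∑ n ∈ s, g n with hG
    have hGn : ‖G‖ ≤ ‖q‖ := IsUltrametricDist.norm_sum_le_of_forall_le_of_nonneg (norm_nonneg q)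
      fun n _ ↦ hgn n
    have hfa1 : ‖f a‖ ≤ 1 := by
      rw [hfg a, norm_pow]
      refine pow_le_one₀ (norm_nonneg _) ((norm_sub_le_max₃ _ _).trans (max_le (by rw [norm_one]) ?_))
      rw [norm_mul, norm_mul]
      calc ‖(2 : ℚ_[3])‖ * ‖c - 1‖ * ‖g a‖ ≤ 1 * 1 * ‖q‖ := by gcongr; exact hgn a
        _ ≤ 1 * 1 * 1 := by gcongr
        _ = 1 := by norm_num
    have e : f a * P - (1 - 4 * (c - 1) * (g a + G)) =
        f a * (P - (1 - 4 * (c - 1) * G)) + 4 * (c - 1) ^ 2 * g a * (4 * G + g a - 4 * (c - 1) * g a * G) := by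
      rw [hfg a]; ring
    rw [e]
    refine (norm_add_le_max _ _).trans (max_le ?_ ?_)
    · rw [norm_mul]
      calc ‖f a‖ * ‖P - (1 - 4 * (c - 1) * G)‖ ≤ 1 * (‖q‖ ^ 2 * ‖c - 1‖ ^ 2) := by gcongr
        _ = ‖q‖ ^ 2 * ‖c - 1‖ ^ 2 := one_mul _
    · have hin : ‖4 * G + g a - 4 * (c - 1) * g a * G‖ ≤ ‖q‖ := by
        refine (norm_sub_le_max₃ _ _).trans (max_le ((norm_add_le_max _ _).trans (max_le ?_ (hgn a))) ?_)
        · rw [norm_mul]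
          calc ‖(4 : ℚ_[3])‖ * ‖G‖ ≤ 1 * ‖q‖ := by gcongr
            _ = ‖q‖ := one_mul _
        · rw [norm_mul, norm_mul, norm_mul]
          calc ‖(4 : ℚ_[3])‖ * ‖c - 1‖ * ‖g a‖ * ‖G‖ ≤ 1 * 1 * ‖q‖ * ‖q‖ := by gcongr; exact hgn a
            _ = ‖q‖ * ‖q‖ := by ring
            _ ≤ ‖q‖ * 1 := by gcongr
            _ = ‖q‖ := mul_one _
      rw [norm_mul, norm_mul, norm_mul, norm_pow]
      calc ‖(4 : ℚ_[3])‖ * ‖c - 1‖ ^ 2 * ‖g a‖ * ‖4 * G + g a - 4 * (c - 1) * g a * G‖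
          ≤ 1 * ‖c - 1‖ ^ 2 * ‖q‖ * ‖q‖ := by gcongr; exact hgn a
        _ = ‖q‖ ^ 2 * ‖c - 1‖ ^ 2 := by ring

/-- **The sigma product to first order in `c − 1`, ALL orders in `q`.** For `‖q‖₃ < 1`, `‖c‖₃ ≤ 1`:
`‖∏_{n≥1} (1 − 2qⁿc + q²ⁿ)²/(1 − qⁿ)⁴ − (1 − 4(c − 1)·s₁(q))‖ ≤ ‖q‖²·‖c − 1‖²`, `s₁(q) = Σ_{n≥1} qⁿ/(1 − qⁿ)² =
Σ σ₁(n)qⁿ` (`= (1 − E₂(q))/24`). With `c = ch L`, `2(c − 1) = L + O(L²)`: `Π = 1 − 2 s₁(q)·L + O(L²)` — the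
`E₂(q)`-term of the `3`-adic height. (Finite version + limits `HasProd`/`HasSum`.) [cite: SteinWuthrich2013, §4.2] -/
theorem norm_tprod_tateSigmaSq_factor_sub_lambert_le {q c : ℚ_[3]} (hq : ‖q‖ < 1) (hc : ‖c‖ ≤ 1) :
    ‖(∏' n : ℕ, (1 - 2 * q ^ (n + 1) * c + q ^ (2 * (n + 1))) ^ 2 / (1 - q ^ (n + 1)) ^ 4) -
        (1 - 4 * (c - 1) * tateS 1 q)‖ ≤ ‖q‖ ^ 2 * ‖c - 1‖ ^ 2 := by
  have hP := (multipliable_tateSigmaSq_factor hq hc).hasProd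
  have hS := hasSum_lambert_one hq
  have hT : Tendsto (fun s : Finset ℕ ↦ (1 : ℚ_[3]) - 4 * (c - 1) * ∑ n ∈ s, q ^ (n + 1) / (1 - q ^ (n + 1)) ^ 2)
      atTop (𝓝 (1 - 4 * (c - 1) * tateS 1 q)) :=
    tendsto_const_nhds.sub (hS.const_mul (4 * (c - 1)))
  have hlim := (hP.sub hT).norm
  exact le_of_tendsto hlim (Filter.Eventually.of_forall fun s ↦
    norm_prod_tateSigmaSq_factor_sub_lambert_le hq hc s)

end Product

/-! ### §17 Abstract bookkeeping for the exact law -/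

section Bookkeeping

/-- **The logarithm of the sigma product, exactly in `q`: `‖log₃ Π + 2 s₁·L‖ ≤ ‖L‖²`.** Abstract bookkeeping:
`log Π + 2KL = [log Π − (Π − 1)] + [Π − (1 − 4(c−1)K)] − 2K·[2(c−1) − L]`, the brackets bounded by
`(‖q‖r²)²`, `‖q‖²‖c−1‖²` (§16) and `3‖L‖²`, with `‖K‖ ≤ ‖q‖ ≤ 3⁻¹`, `‖c − 1‖ ≤ ‖L‖ = r²`. [folklore] -/
theorem exact_logPr {q c L K P : ℚ_[3]} {r : ℝ} (hq3 : ‖q‖ ≤ 3⁻¹) (hLn : ‖L‖ = r ^ 2)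
    (hK : ‖K‖ ≤ ‖q‖) (hc1 : ‖c - 1‖ ≤ ‖L‖)
    (hPrK : ‖P - (1 - 4 * (c - 1) * K)‖ ≤ ‖q‖ ^ 2 * ‖c - 1‖ ^ 2)
    (hlogPr : ‖padicLog 3 P - (P - 1)‖ ≤ (‖q‖ * r ^ 2) ^ 2) (hcL : ‖2 * (c - 1) - L‖ ≤ 3 * ‖L‖ ^ 2) :
    ‖padicLog 3 P + 2 * K * L‖ ≤ r ^ 4 := by
  have h2n : ‖(2 : ℚ_[3])‖ = 1 := by
    simpa using Padic.norm_natCast_eq_one_iff.mpr (show Nat.Coprime 3 2 by decide)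
  have hq0 : 0 ≤ ‖q‖ := norm_nonneg _
  have hq1 : ‖q‖ ≤ 1 := hq3.trans (by norm_num)
  have hr2 : 0 ≤ r ^ 2 := by rw [← hLn]; exact norm_nonneg _
  have e : padicLog 3 P + 2 * K * L =
      (padicLog 3 P - (P - 1)) + (P - (1 - 4 * (c - 1) * K)) - 2 * K * (2 * (c - 1) - L) := by ring
  rw [e]
  have hr4 : r ^ 4 = r ^ 2 * r ^ 2 := by ring
  refine (norm_sub_le_max₃ _ _).trans (max_le ((norm_add_le_max _ _).trans (max_le (hlogPr.trans ?_)
    (hPrK.trans ?_))) ?_)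
  · rw [hr4]
    calc (‖q‖ * r ^ 2) ^ 2 = (‖q‖ * ‖q‖) * (r ^ 2 * r ^ 2) := by ring
      _ ≤ (1 * 1) * (r ^ 2 * r ^ 2) := by gcongr
      _ = r ^ 2 * r ^ 2 := by ring
  · rw [hr4]
    calc ‖q‖ ^ 2 * ‖c - 1‖ ^ 2 ≤ 1 ^ 2 * ‖L‖ ^ 2 := by gcongr
      _ = r ^ 2 * r ^ 2 := by rw [hLn]; ring
  · rw [norm_mul, norm_mul, h2n, one_mul]
    calc ‖K‖ * ‖2 * (c - 1) - L‖ ≤ ‖q‖ * (3 * ‖L‖ ^ 2) := by gcongr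
      _ ≤ 3⁻¹ * (3 * ‖L‖ ^ 2) := by gcongr
      _ = r ^ 4 := by rw [hLn]; ring

/-- **The corrected scale is a unit**: `‖C·(1 − 24K)‖ = 1` for `‖C‖ = 1`, `‖K‖ ≤ ‖q‖ < 1`. [folklore] -/
theorem norm_lambertScale_eq_one {C K q : ℚ_[3]} (hC : ‖C‖ = 1) (hK : ‖K‖ ≤ ‖q‖) (hq : ‖q‖ < 1) :
    ‖C * (1 - 24 * K)‖ = 1 := by
  have h24 : ‖(24 : ℚ_[3])‖ ≤ 1 := by
    rw [show (24 : ℚ_[3]) = ((24 : ℤ) : ℚ_[3]) by norm_cast]; exact Padic.norm_int_le_one _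
  have hlt : ‖24 * K‖ < 1 := by
    rw [norm_mul]
    calc ‖(24 : ℚ_[3])‖ * ‖K‖ ≤ 1 * ‖q‖ := by gcongr
      _ = ‖q‖ := one_mul _
      _ < 1 := hq
  rw [norm_mul, hC, norm_one_sub_eq_one hlt, one_mul]

/-- **The corrected scale is `b₂` to first order**: `‖C(1 − 24K) − b₂‖ ≤ 3⁻¹` from `‖C − b₂‖ ≤ 3⁻¹`, `‖C‖ = 1`,
`‖K‖ ≤ ‖q‖ ≤ 3⁻¹` (`‖24‖₃ = 3⁻¹`). [folklore] -/
theorem norm_lambertScale_sub_le {C K q b₂ : ℚ_[3]} (hC : ‖C‖ = 1) (hK : ‖K‖ ≤ ‖q‖) (hq3 : ‖q‖ ≤ 3⁻¹)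
    (hCb : ‖C - b₂‖ ≤ 1 / 3) : ‖C * (1 - 24 * K) - b₂‖ ≤ 1 / 3 := by
  have h24 : ‖(24 : ℚ_[3])‖ ≤ 1 := by
    rw [show (24 : ℚ_[3]) = ((24 : ℤ) : ℚ_[3]) by norm_cast]; exact Padic.norm_int_le_one _
  rw [show C * (1 - 24 * K) - b₂ = (C - b₂) - 24 * (C * K) by ring]
  refine (norm_sub_le_max₃ _ _).trans (max_le hCb ?_)
  rw [norm_mul, norm_mul, hC, one_mul]
  calc ‖(24 : ℚ_[3])‖ * ‖K‖ ≤ 1 * ‖q‖ := by gcongr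
    _ ≤ 1 * 3⁻¹ := by gcongr
    _ = 1 / 3 := by norm_num

/-- **The `ℓ⁴`-coefficient correction is a `3`-adic integer**: `‖((C(1 − 24K))² − C²)/1440‖ ≤ 1` for `‖C‖ = 1`,
`‖K‖ ≤ ‖q‖ ≤ 3⁻¹` (`(C(1−24K))² − C² = −48·C²K(1 − 12K)`, `‖48‖₃ = 3⁻¹`, `‖1440⁻¹‖₃ = 9`). [folklore] -/
theorem norm_lambertScale_sq_sub_sq_div_le {C K q : ℚ_[3]} (hC : ‖C‖ = 1) (hK : ‖K‖ ≤ ‖q‖)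
    (hq3 : ‖q‖ ≤ 3⁻¹) : ‖((C * (1 - 24 * K)) ^ 2 - C ^ 2) / 1440‖ ≤ 1 := by
  have h1440 : ‖(1440 : ℚ_[3])⁻¹‖ = 9 := by
    have h160 : ‖(160 : ℚ_[3])‖ = 1 := by
      simpa using Padic.norm_natCast_eq_one_iff.mpr (show Nat.Coprime 3 160 by decide)
    have h3i : ‖(3 : ℚ_[3])⁻¹‖ = 3 := by
      rw [norm_inv, show (3 : ℚ_[3]) = ((3 : ℕ) : ℚ_[3]) by norm_cast, Padic.norm_p]; norm_num
    rw [show (1440 : ℚ_[3]) = 160 * (3 * 3) by norm_num, mul_inv, mul_inv, norm_mul, norm_mul, h3i, norm_inv,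
      h160]; norm_num
  have h48 : ‖(48 : ℚ_[3])‖ ≤ 1 / 3 := by
    rw [show (48 : ℚ_[3]) = ((16 : ℤ) : ℚ_[3]) * 3 by norm_num, norm_mul,
      show (3 : ℚ_[3]) = ((3 : ℕ) : ℚ_[3]) by norm_cast, Padic.norm_p]
    calc ‖((16 : ℤ) : ℚ_[3])‖ * (↑(3 : ℕ) : ℝ)⁻¹ ≤ 1 * (↑(3 : ℕ) : ℝ)⁻¹ := by
          gcongr; exact Padic.norm_int_le_one 16
      _ = 1 / 3 := by norm_num
  have h12 : ‖(12 : ℚ_[3])‖ ≤ 1 := by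
    rw [show (12 : ℚ_[3]) = ((12 : ℤ) : ℚ_[3]) by norm_cast]; exact Padic.norm_int_le_one _
  have hin : ‖1 - 12 * K‖ ≤ 1 := by
    refine (norm_sub_le_max₃ _ _).trans (max_le (by rw [norm_one]) ?_)
    rw [norm_mul]
    calc ‖(12 : ℚ_[3])‖ * ‖K‖ ≤ 1 * ‖q‖ := by gcongr
      _ ≤ 1 * 3⁻¹ := by gcongr
      _ ≤ 1 := by norm_num
  rw [show ((C * (1 - 24 * K)) ^ 2 - C ^ 2) / 1440 = -(48 * (C ^ 2 * (K * (1 - 12 * K)))) * (1440 : ℚ_[3])⁻¹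
    by ring, norm_mul, norm_neg, h1440, norm_mul, norm_mul, norm_mul, norm_pow, hC, one_pow, one_mul]
  calc ‖(48 : ℚ_[3])‖ * (‖K‖ * ‖1 - 12 * K‖) * 9 ≤ (1 / 3) * (‖q‖ * 1) * 9 := by gcongr
    _ ≤ (1 / 3) * (3⁻¹ * 1) * 9 := by gcongr
    _ = 1 := by norm_num

end Bookkeeping

end Summit.BirchSwinnertonDyer.Rank1Residual.X11b.RegMult.HeightLogNumerator

end
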